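import Summits.HodgeConjecture.CorCM.D2Bridge.Thm418CombinedOfPrintedPropositions
import Summits.HodgeConjecture.CorCM.D2Bridge.HcmPieces
import HarnessLib

/-!
# Δ2 BRIDGE — the resolved increment OVER THE PIECES S1–S4, pin-facing forms (pieces only at SMALL LEVELS)

Cell pub-hodgecm2 (COR-CM), Δ2 BRIDGE; assembler seat planner-pub-hodgecm2-d2bridge-plan-g0-0 (bytes), filed by a d2bridge prover.
THREE theorems, no `def`, no named fact, composing landed∕pending modules only:
* `Summit.HodgeConjecture.CorCM.D2Bridge.thm418Combined_of_printedPropositions_of_pieces` — d2bridge-prove-2's ✔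
  `thm418Combined_of_printedPropositions_records` (p365053; `Prop413Data` currency: [Liu2021] Prop. 4.13, Def. 4.11, Thm. 4.18 (1)(2),
  Lem. D.1 (3) AS PRINTED + the rational record of the proof's map (4.2)∕(4.3)) with its CM-side contract `hcm` CUT INTO THE FOUR PIECES
  `HcmPieces` (module `CorCM.D2Bridge.HcmPieces`, d2bridge-prove-4 v4) via the sorry-free assembly `hcm_of_pieces`;
* `…thm418Combined_of_printedPropositions_of_pieces_small` — the same with `pieces` asked ONLY for levels `K ≤ Ks μ` (any threshold
  family; at the pin the level of App. C's `K₀`, below which the model's `res K` IS the restriction of level-`K` classes — v4 §Small levels: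
  `thm418Combined_of_subset_below` + `nonempty_hcmPieces_univ`); needs `SemilatticeInf Lvl`;
* `HodgeCM.Literature.Theta.LiuAlbaneseModuleDatum.D2Bridge.thm418Combined_of_asPrinted_resolved_of_decomposition_small` — the App-C
  currency pin-facing form: v4's `thm418Combined_of_asPrinted_resolved_small` with the multiplicity pin `hmultD` DERIVED from a
  Prop-4.13-shaped decomposition (`rank_intertwiningMap_le_one_of_decomposition`, own-htheta g9's Schur step).
Hole-free (no `HodgeCM.Model.Universe` import); outside the port manifest.  HC_CM is NOT proved; «Δ2 BRIDGE CLOSED» is NOT claimed;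
no pin (Ω, J, S1–S4, `Ks`) is discharged here — the surviving binders ARE the residual.

## References
* [Liu2021] Y. Liu, *Fourier–Jacobi cycles and arithmetic relative trace formula*, Camb. J. Math. 9 (2021) = arXiv:2102.11518 —
  Prop. 4.13 (l. 2113–2119), Def. 4.11, Thm. 4.18 (l. 2232–2245) with proof (l. 2247–2268), Thm. 4.18 (1) («sufficiently small»),
  Lem. 2.4 (1), Def. 4.5 (2), App. D Lem. D.1 (1), (3).
* [Bump1997] D. Bump, *Automorphic forms and representations*, CUP 1997 — Prop. 4.2.4.
-/

set_option autoImplicit false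

noncomputable section

open scoped TensorProduct DirectSum

namespace Summit.HodgeConjecture.CorCM.D2Bridge

open HodgeCM.Literature.Theta HodgeCM.Literature.Theta.LiuAlbaneseModuleDatum
open HodgeCM.Literature.Theta.LiuAlbaneseModuleDatum.D2Bridge
open Literature.NumberTheory.Automorphic Literature.NumberTheory.Automorphic.Liu2021 Literature.RepresentationTheory NumberField

universe v' w'

variable {F E : Type} [Field F] [NumberField F] [IsTotallyReal F] [Field E] [NumberField E] [Algebra F E]
  [IsTotallyComplex E] [Algebra.IsQuadraticExtension F E]

/-- **[Liu2021] Thm 4.18 + Prop 4.13 + Def 4.11 + Lem D.1 (3) AS PRINTED, over the rational record, with the CM-side contract `hcm` CUT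
INTO THE FOUR PIECES S1–S4 (`HcmPieces`)**: `thm418Combined_of_printedPropositions_records` composed with `hcm_of_pieces`.
[cite: Liu2021, Prop. 4.13 (ll. 2113–2119); Def. 4.11; Thm. 4.18 (ll. 2232–2245) and its proof (ll. 2247–2268); Lem. 2.4 (1); Def. 4.5 (2); App. D Lemma D.1 (3)]
[cite: Bump1997, Proposition 4.2.4] -/
theorem thm418Combined_of_printedPropositions_of_pieces
    (P : Prop413Data F E) (hn : 3 ≤ P.n) (τ' : E →+* ℂ) (h413 : Prop413AsPrinted P)
    (h411 : ∀ t : P.AdmTriple,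
      IsIrreducibleOrZero (P.rhoAt t) ∧ IsSmoothRep (P.rhoAt t) ∧ IsAdmissibleRep (P.rhoAt t))
    (hsep : ∀ s t : P.AdmTriple, Nontrivial (P.omegaAt s) →
      (∃ f : P.omegaAt s ≃ₗ[ℂ] P.omegaAt t, ∀ (g : P.G) (v : P.omegaAt s), f (P.rhoAt s g v) = P.rhoAt t g (f v)) →
      s = t)
    {Lvl : Type v'} [Preorder Lvl] {Kof : Lvl → Subgroup P.G} (T : LiuAlbaneseModuleDatum P.G Kof)
    {W : Lvl → Type w'} [∀ K, AddCommGroup (W K)] [∀ K, Module ℂ (W K)]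
    (res : ∀ K : Lvl, T.H →ₗ[ℂ] W K) (cmCl : ∀ K : Lvl, T.Char → Set (W K))
    (hmono : ∀ ⦃K K' : Lvl⦄, K ≤ K' → Kof K ≤ Kof K') (hoc : ∀ K : Lvl, IsOpenCompact (Kof K))
    (hcof : ∀ K₀ : Subgroup P.G, IsOpenCompact K₀ → ∃ K₁ : Lvl, Kof K₁ ≤ K₀)
    (eH : P.HB τ' ≃ₗ[ℂ] T.H)
    (heH : ∀ (g : P.G) (x : P.HB τ'), eH (P.rhoB τ' g x) = MonoidAlgebra.of ℂ P.G g • eH x)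
    (ν : ∀ μ : T.Char, T.PhiMu μ → (IdeleClassGroup E →ₜ* Circle))
    (R : ∀ (μ : T.Char) (hμ : T.PhiMu μ), P.Rest418 (ν μ hμ))
    (hLiu : ∀ (μ : T.Char) (hμ : T.PhiMu μ), Thm418AsPrinted (P.toThm418Data (R μ hμ)))
    (σ : ∀ (μ : T.Char) (hμ : T.PhiMu μ), T.Adm μ → (P.toThm418Data (R μ hμ)).AdmIndex)
    (hσ : ∀ (μ : T.Char) (hμ : T.PhiMu μ), Function.Injective (σ μ hμ))
    (e : ∀ (μ : T.Char) (hμ : T.PhiMu μ) (a : T.Adm μ), T.Ω μ a ≃ₗ[ℂ] (P.toThm418Data (R μ hμ)).omegaAt (σ μ hμ a))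
    (he : ∀ (μ : T.Char) (hμ : T.PhiMu μ) (a : T.Adm μ) (g : P.G) (m : T.Ω μ a),
      e μ hμ a (MonoidAlgebra.of ℂ P.G g • m) = (P.toThm418Data (R μ hμ)).rhoAt (σ μ hμ a) g (e μ hμ a m))
    (M : ∀ (μ : T.Char) (hμ : T.PhiMu μ), (P.toThm418Data (R μ hμ)).Map43RationalData)
    (jH : ∀ (μ : T.Char) (hμ : T.PhiMu μ), (M μ hμ).HB →ₗ[ℂ] T.H)
    (hjHinj : ∀ (μ : T.Char) (hμ : T.PhiMu μ), Function.Injective (jH μ hμ))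
    (hjH : ∀ (μ : T.Char) (hμ : T.PhiMu μ) (g : P.G) (x : (M μ hμ).HB),
      jH μ hμ ((M μ hμ).ρB g x) = MonoidAlgebra.of ℂ P.G g • jH μ hμ x)
    -- ── X2 RESOLVED: the four pieces S1–S4 per (μ, level K) ──
    (pieces : ∀ (μ : T.Char) (hμ : T.PhiMu μ) (K : Lvl),
      HcmPieces (P.toThm418Data (R μ hμ)) (M μ hμ) T.H (jH μ hμ) (Kof K) (W K) (res K) (cmCl K μ)) :
    T.Thm418Combined res cmCl :=
  thm418Combined_of_printedPropositions_records P hn τ' h413 h411 hsep T res cmCl hmono hoc hcof eH heH ν R hLiu σ hσ e he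
    M jH hjHinj hjH (fun μ hμ K φ => hcm_of_pieces (pieces μ hμ K) φ)

/-- **The same, with the pieces asked ONLY AT SMALL LEVELS** (`K ≤ Ks μ` for any threshold family `Ks`; at the pin the level of
App. C's `K₀`, below which the model's `res K` IS the restriction of level-`K` classes — prove-4's v4 §Small levels, HOME/INBOX l. 10826):
KERNEL = the all-levels form at the generator sets `{x | K ≤ Ks μ → x ∈ cmCl K μ}` (trivial pieces `nonempty_hcmPieces_univ` above the
threshold) + `thm418Combined_of_subset_below`.  Needs binary infima of levels (`SemilatticeInf Lvl`; `HodgeCM.Level V` has them).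
[cite: Liu2021, Prop. 4.13 (ll. 2113–2119); Def. 4.11; Thm. 4.18 (1) («sufficiently small»), (2) and its proof (ll. 2247–2268); Lem. 2.4 (1); Def. 4.5 (2); App. D Lemma D.1 (3)]
[cite: Bump1997, Proposition 4.2.4] -/
theorem thm418Combined_of_printedPropositions_of_pieces_small
    (P : Prop413Data F E) (hn : 3 ≤ P.n) (τ' : E →+* ℂ) (h413 : Prop413AsPrinted P)
    (h411 : ∀ t : P.AdmTriple,
      IsIrreducibleOrZero (P.rhoAt t) ∧ IsSmoothRep (P.rhoAt t) ∧ IsAdmissibleRep (P.rhoAt t))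
    (hsep : ∀ s t : P.AdmTriple, Nontrivial (P.omegaAt s) →
      (∃ f : P.omegaAt s ≃ₗ[ℂ] P.omegaAt t, ∀ (g : P.G) (v : P.omegaAt s), f (P.rhoAt s g v) = P.rhoAt t g (f v)) →
      s = t)
    {Lvl : Type v'} [SemilatticeInf Lvl] {Kof : Lvl → Subgroup P.G} (T : LiuAlbaneseModuleDatum P.G Kof)
    {W : Lvl → Type w'} [∀ K, AddCommGroup (W K)] [∀ K, Module ℂ (W K)]
    (res : ∀ K : Lvl, T.H →ₗ[ℂ] W K) (cmCl : ∀ K : Lvl, T.Char → Set (W K))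
    (hmono : ∀ ⦃K K' : Lvl⦄, K ≤ K' → Kof K ≤ Kof K') (hoc : ∀ K : Lvl, IsOpenCompact (Kof K))
    (hcof : ∀ K₀ : Subgroup P.G, IsOpenCompact K₀ → ∃ K₁ : Lvl, Kof K₁ ≤ K₀)
    (eH : P.HB τ' ≃ₗ[ℂ] T.H)
    (heH : ∀ (g : P.G) (x : P.HB τ'), eH (P.rhoB τ' g x) = MonoidAlgebra.of ℂ P.G g • eH x)
    (ν : ∀ μ : T.Char, T.PhiMu μ → (IdeleClassGroup E →ₜ* Circle))
    (R : ∀ (μ : T.Char) (hμ : T.PhiMu μ), P.Rest418 (ν μ hμ))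
    (hLiu : ∀ (μ : T.Char) (hμ : T.PhiMu μ), Thm418AsPrinted (P.toThm418Data (R μ hμ)))
    (σ : ∀ (μ : T.Char) (hμ : T.PhiMu μ), T.Adm μ → (P.toThm418Data (R μ hμ)).AdmIndex)
    (hσ : ∀ (μ : T.Char) (hμ : T.PhiMu μ), Function.Injective (σ μ hμ))
    (e : ∀ (μ : T.Char) (hμ : T.PhiMu μ) (a : T.Adm μ), T.Ω μ a ≃ₗ[ℂ] (P.toThm418Data (R μ hμ)).omegaAt (σ μ hμ a))
    (he : ∀ (μ : T.Char) (hμ : T.PhiMu μ) (a : T.Adm μ) (g : P.G) (m : T.Ω μ a),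
      e μ hμ a (MonoidAlgebra.of ℂ P.G g • m) = (P.toThm418Data (R μ hμ)).rhoAt (σ μ hμ a) g (e μ hμ a m))
    (M : ∀ (μ : T.Char) (hμ : T.PhiMu μ), (P.toThm418Data (R μ hμ)).Map43RationalData)
    (jH : ∀ (μ : T.Char) (hμ : T.PhiMu μ), (M μ hμ).HB →ₗ[ℂ] T.H)
    (hjHinj : ∀ (μ : T.Char) (hμ : T.PhiMu μ), Function.Injective (jH μ hμ))
    (hjH : ∀ (μ : T.Char) (hμ : T.PhiMu μ) (g : P.G) (x : (M μ hμ).HB),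
      jH μ hμ ((M μ hμ).ρB g x) = MonoidAlgebra.of ℂ P.G g • jH μ hμ x)
    -- ── X2 RESOLVED BELOW THE THRESHOLD: the four pieces S1–S4 per (μ, level K ≤ Ks μ) ──
    (Ks : T.Char → Lvl)
    (pieces : ∀ (μ : T.Char) (hμ : T.PhiMu μ) (K : Lvl), K ≤ Ks μ →
      HcmPieces (P.toThm418Data (R μ hμ)) (M μ hμ) T.H (jH μ hμ) (Kof K) (W K) (res K) (cmCl K μ)) :
    T.Thm418Combined res cmCl := by
  have hP : ∀ (μ : T.Char) (hμ : T.PhiMu μ) (K : Lvl),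
      Nonempty (HcmPieces (P.toThm418Data (R μ hμ)) (M μ hμ) T.H (jH μ hμ) (Kof K) (W K) (res K)
        {x | K ≤ Ks μ → x ∈ cmCl K μ}) := by
    intro μ hμ K
    by_cases hK : K ≤ Ks μ
    · exact HcmPieces.nonempty_mono (fun x hx _ => hx) (pieces μ hμ K hK)
    · exact HcmPieces.nonempty_mono (fun x _ hK' => absurd hK' hK)
        (Classical.choice (nonempty_hcmPieces_univ _ _ T.H (jH μ hμ) (Kof K) (W K) (res K)))
  have h' : T.Thm418Combined res (fun K μ => {x | K ≤ Ks μ → x ∈ cmCl K μ}) :=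
    thm418Combined_of_printedPropositions_of_pieces P hn τ' h413 h411 hsep T res (fun K μ => {x | K ≤ Ks μ → x ∈ cmCl K μ})
      hmono hoc hcof eH heH ν R hLiu σ hσ e he M jH hjHinj hjH (fun μ hμ K => Classical.choice (hP μ hμ K))
  exact thm418Combined_of_subset_below (cmCl' := fun K μ => {x | K ≤ Ks μ → x ∈ cmCl K μ}) Ks
    (fun μ K hK x (hx : K ≤ Ks μ → x ∈ cmCl K μ) => hx hK) h'

end Summit.HodgeConjecture.CorCM.D2Bridge

namespace HodgeCM.Literature.Theta.LiuAlbaneseModuleDatum.D2Bridge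

open HodgeCM.Literature.Theta HodgeCM.Literature.Theta.LiuAlbaneseModuleDatum
open Summit.HodgeConjecture.CorCM
open Literature.AlgebraicGeometry.ShimuraVarieties.UnitaryCanonicalModel
open Literature.NumberTheory.Automorphic.Liu2021 Literature.NumberTheory.Automorphic.Liu2021.AppendixC NumberField
open Literature.RepresentationTheory

universe v'' w''

/-- **THE PIN-FACING APP-C FORM: pieces only at small levels AND the multiplicity pin derived from [Liu2021, Prop. 4.13]'s statement
shape** — `thm418Combined_of_asPrinted_resolved_small` (prove-4, v4) with `hmultD` supplied by `rank_intertwiningMap_le_one_of_decomposition`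
(own-htheta g9's Schur step).  SURVIVING BINDERS: DATA `C ∕ R ∕ Good ∕ hbad ∕ Ks`; CITES AS PRINTED `hLiu` [Thm. 4.18], `σ413 ∕ Φ413 ∕ hΦ413`
[Prop. 4.13 shape], `h411W ∕ hirrD` [Def. 4.11], `hsepW` [Thm. 4.18 (2) ∕ Lem. D.1 (3)], `hnvD` [Lem. D.1 (1)]; X-PINS `σ ∕ hσ ∕ e ∕ he` (Ω),
`M ∕ jH ∕ hjHinj ∕ hjH` (J), `pieces` below `Ks` (S1–S4).  HC_CM is NOT proved; no pin is discharged here.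
[cite: Liu2021, Thm. 4.18 (l. 2232–2245) with proof l. 2247–2268, Thm. 4.18 (1) («sufficiently small»), (2), Prop. 4.13 (l. 2113–2119), Def. 4.11, Lem. 2.4 (1), Def. 4.5 (2), App. D Lem. D.1 (1), (3)]
[cite: Bump1997, Proposition 4.2.4] -/
theorem thm418Combined_of_asPrinted_resolved_of_decomposition_small
    {L : HodgeCM.CMField} {ι₁ : L →+* ℂ} (V : HodgeCM.HermSpace3 L ι₁)
    (h : exists_recordSystem) (Φ : Literature.AlgebraicGeometry.Motives.CMType L)
    {isotropicAt : ℕ → Prop}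
    (C : Sec42Data (Model.honestP5Of h ⟨L.K⟩ ι₁ ⟨V.Hm, V.isHermitian, V.signature_ι₁, V.posDef_of_ne⟩ Φ) isotropicAt)
    (T : LiuAlbaneseModuleDatum ↥V.adelicFin (HodgeCM.Level.K : HodgeCM.Level V → Subgroup ↥V.adelicFin))
    {W : HodgeCM.Level V → Type w''} [∀ K, AddCommGroup (W K)] [∀ K, Module ℂ (W K)]
    (res : ∀ K : HodgeCM.Level V, T.H →ₗ[ℂ] W K) (cmCl : ∀ K : HodgeCM.Level V, T.Char → Set (W K))
    (Good : T.Char → Prop) (hbad : ∀ μ : T.Char, T.PhiMu μ → ¬ Good μ → T.block μ = ⊥)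
    (R : ∀ μ : T.Char, T.PhiMu μ → Good μ → Thm418Rest C)
    (hLiu : ∀ (μ : T.Char) (hμ : T.PhiMu μ) (hg : Good μ), Thm418AsPrinted (toThm418Data C (R μ hμ hg)))
    (σ : ∀ (μ : T.Char) (hμ : T.PhiMu μ) (hg : Good μ), T.Adm μ → (toThm418Data C (R μ hμ hg)).AdmIndex)
    (hσ : ∀ (μ : T.Char) (hμ : T.PhiMu μ) (hg : Good μ), Function.Injective (σ μ hμ hg))
    (e : ∀ (μ : T.Char) (hμ : T.PhiMu μ) (hg : Good μ) (a : T.Adm μ),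
      T.Ω μ a ≃ₗ[ℂ] (toThm418Data C (R μ hμ hg)).omegaAt (σ μ hμ hg a))
    (he : ∀ (μ : T.Char) (hμ : T.PhiMu μ) (hg : Good μ) (a : T.Adm μ) (g : ↥V.adelicFin) (m : T.Ω μ a),
      e μ hμ hg a (MonoidAlgebra.of ℂ ↥V.adelicFin g • m) = (toThm418Data C (R μ hμ hg)).rhoAt (σ μ hμ hg a) g (e μ hμ hg a m))
    (M : ∀ (μ : T.Char) (hμ : T.PhiMu μ) (hg : Good μ), (toThm418Data C (R μ hμ hg)).Map43RationalData)
    (jH : ∀ (μ : T.Char) (hμ : T.PhiMu μ) (hg : Good μ), (M μ hμ hg).HB →ₗ[ℂ] T.H)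
    (hjHinj : ∀ (μ : T.Char) (hμ : T.PhiMu μ) (hg : Good μ), Function.Injective (jH μ hμ hg))
    (hjH : ∀ (μ : T.Char) (hμ : T.PhiMu μ) (hg : Good μ) (g : ↥V.adelicFin) (x : (M μ hμ hg).HB),
      jH μ hμ hg ((M μ hμ hg).ρB g x) = MonoidAlgebra.of ℂ ↥V.adelicFin g • jH μ hμ hg x)
    -- ── X2 RESOLVED BELOW THE THRESHOLD ──
    (Ks : T.Char → HodgeCM.Level V)
    (pieces : ∀ (μ : T.Char) (hμ : T.PhiMu μ) (hg : Good μ) (K : HodgeCM.Level V), K ≤ Ks μ →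
      HcmPieces.{0, v'', w''} (toThm418Data C (R μ hμ hg)) (M μ hμ hg) T.H (jH μ hμ hg) K.K (W K) (res K) (cmCl K μ))
    -- ── [Lem D.1 (1)] and [Def 4.11] at the rest ──
    (hnvD : ∀ (μ : T.Char) (hμ : T.PhiMu μ) (hg : Good μ) (i : (toThm418Data C (R μ hμ hg)).AdmIndex),
      Nontrivial ((toThm418Data C (R μ hμ hg)).omegaAt i))
    (hirrD : ∀ (μ : T.Char) (hμ : T.PhiMu μ) (hg : Good μ) (i : (toThm418Data C (R μ hμ hg)).AdmIndex),
      IsIrreducibleOrZero ((toThm418Data C (R μ hμ hg)).rhoAt i))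
    -- ── [Prop 4.13]'s STATEMENT shape at the tower ──
    {ι413 : Type} {W413 : ι413 → Type} [∀ t, AddCommGroup (W413 t)] [∀ t, Module ℂ (W413 t)]
    (σ413 : ∀ t : ι413, Representation ℂ ↥V.adelicFin (W413 t))
    (Φ413 : T.H ≃ₗ[ℂ] ⨁ t, W413 t)
    (hΦ413 : ∀ (g : ↥V.adelicFin) (x : T.H) (t : ι413),
      Φ413 (Representation.ofModule' (k := ℂ) (G := ↥V.adelicFin) T.H g x) t = σ413 t g (Φ413 x t))
    (h411W : ∀ t : ι413, IsIrreducibleOrZero (σ413 t) ∧ IsSmoothRep (σ413 t) ∧ IsAdmissibleRep (σ413 t))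
    (hsepW : ∀ s t : ι413, Nontrivial (W413 s) →
      (∃ f : W413 s ≃ₗ[ℂ] W413 t, ∀ (g : ↥V.adelicFin) (v : W413 s), f (σ413 s g v) = σ413 t g (f v)) → s = t) :
    T.Thm418Combined res cmCl :=
  thm418Combined_of_asPrinted_resolved_small V h Φ C T res cmCl Good hbad R hLiu σ hσ e he M jH hjHinj hjH Ks pieces hnvD
    fun μ hμ hg i =>
      haveI := hnvD μ hμ hg i
      rank_intertwiningMap_le_one_of_decomposition V (Hc := T.H) ((toThm418Data C (R μ hμ hg)).rhoAt i)
        (hirrD μ hμ hg i) σ413 Φ413 hΦ413 h411W hsepW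

end HodgeCM.Literature.Theta.LiuAlbaneseModuleDatum.D2Bridge

end
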